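import Mathlib
import Summits.NavierStokesRegularity.NavierStokesRegularity.Theses.QuarterLogPincer
import Literature.Analysis.FluidPDE.ClassicalSolution
import Literature.Analysis.FluidPDE.SelfSimilar
import Literature.Analysis.FluidPDE.TypeIAncientMild
import Literature.Analysis.FluidPDE.AncientL3BackwardLiouvilleHolds
import Summits.NavierStokesRegularity.NavierStokesRegularity.Theorems.DssFarFieldSlavingBlowupTypeIDssProfileSimilarityEnstrophyTimeOnlyThreshold

/-!
# Line `log-blowdown` for crux `QuarterLogPincer.TypeIQuantSubcubicExp` (stmt-NavierStokesRegularity-24077)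

ns-idea-7 g2 (lens «nearmiss», target «DSS wall»).  No summit is proved by this line.

NEAR-MISS OF RECORD.  The Escauriaza–Seregin–Šverák / Albritton–Barker backward-uniqueness road
PROVES (tree theorem `Literature.Analysis.FluidPDE.albrittonBarker_liouville_L3_core`, A–B 2019
Thm 1.2 = arXiv:1811.00502 Thm 1.2, discharged in `AncientL3BackwardLiouvilleHolds`): an ancient
Oseen-mild field whose slices are bounded in `L³(ℝ³)` along times `s_k → −∞` vanishes.  A backward
λ-DSS Type-I profile — the wall object of this crux — misses that hypothesis by EXACTLY A LOGARITHM: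
its slice at time `s` has `∫_{B(0, r)} |v(s)|³ ≤ a + q · log (r/√(−s))` for `r ≥ √(−s)` with
`q = q_DSS > 0` (one λ-period of `∮|Γ|³` per λ-octave beyond the parabolic ball), never `q = 0`.
The measured deficit is the LOG-SLOPE `q` of the blow-down `L³` budget — equivalently (v2) the
PER-OCTAVE CAP: octave costs uniformly `ℓ¹` (known, A–B) versus uniformly bounded (needed):
known `q = 0`, needed `q > 0`.  The single input to improve is the deciding stub `stub_logBlowdownLiouville` (all `q`),
whose two edges are THEOREMS proved below from the tree: `q = 0` (every `M`;
`logBlowdownLiouville_of_slope_zero`, from A–B Thm 1.2) and `M < 1` (every `q`;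
`logBlowdownLiouville_of_rate_lt_one`, from T31⁗).  The open quadrant `M ≥ 1, q > 0` contains the
DSS wall (width 0 there: a converged backward-DSS Type-I profile of any ratio refutes the stub,
24077 and SuperlogCubeRate at once).

THESIS OF THE LINE.  `F_M(A) = exp(o(A³))` fails iff smooth Type-I(M) solutions carry `K → ∞`
octaves of concentration whose `L³` cost is UNIFORMLY cheap in space–time: at every time `t` of the
last `e^{2K}ρ²` before the observation time, the ball of every radius `r` between the parabolic
radius `√(T−t)` and the window top `e^{K}ρ` costs at most `a + q log (r/√(T−t))`
(`UniformlyCheapCascade`; `stub_uniformlyCheapCascades` — the Type-I rate pays the parabolic ball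
and the first `(1/3) log (q / M³)` octaves beyond it at EVERY time, the two-parameter rising-sun
lemma over (octave, parabolic time-band) cells pays the rest on average; the named enemy is an
inward-tracking fat shell, see the stub).  Uniformly cheap cascades of unbounded length rescale
(zoom at the window base) and converge to a LOG-BLOWDOWN PROFILE (`LogBlowdownProfile`): a Type-I
ancient mild field in the tree's canonical Oseen gauge (`IsTypeIAncientMild M v`), singular at the
space–time origin, with Seregin's scaled local energies bounded at ALL scales up to the final time
(so it lives in the Albritton–Barker local-energy Type-I frame, where slab compactness
`SuitableCompactness_holds` and persistence of singularities `PersistenceOfSingularities_holds`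
are tree theorems) and with the logarithmic blow-down slice budget above
(`stub_logBlowdownExtraction`).  The deciding obligation `stub_logBlowdownLiouville` says no such
profile exists; the kernel-checked composition `TypeIQuantSubcubicExp_of` proves the crux BY NAME
from the three stubs.

DIFFERS FROM line `thin-cascade` (g0, same crux): that line budgets only the FINAL-TIME TRACE
(annuli of the weak trace `g`) and its deciding Liouville has no proved large-`M` edge; this line
budgets the BLOW-DOWN SLICES, which is exactly the datum the ESS/A–B backward-uniqueness engine
consumes, so the `q = 0` edge is a theorem for every `M` and the open content is the log-slope
alone.  It also makes explicit (in STUB 1, not in the compactness step) the dynamical input both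
lines need: Type-I in time does not by itself bound local energies up to the blow-up time
(Albritton–Barker 2019, Remark 3.2); uniform cheapness is what supplies them.

VERSION 2 (prices of idea-crit-7's PASS-WITH-PRICE, 2026-08-28T05:43:01Z, paid in place).
P1 (typing): the hypothesis-side object `UniformlyCheapCascade` now records what STUB 1's plan
actually delivers — a CORE clause (`∫_{B(x₀,√(T−t))} ‖u(t)‖³ ≤ a`) and a PER-OCTAVE CAP (every
`e`-adic octave `e^j √(T−t) ≤ |x−x₀| < e^{j+1} √(T−t)` below the window top costs `≤ q` at every
time of the window) — instead of the origin-centred CUMULATIVE budget, which does not subtract and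
therefore did not give STUB 2 the off-centre scaled energies it needs; the cumulative budget
`a + q · #octaves`, Seregin's `C(r;x)`/`D(r;x)` at all centres and the all-centres scaled-`L²`
clause now follow by geometric summation (see STUB 2).  The profile class keeps the cumulative
clause (it is what the Albritton–Barker edge consumes) and GAINS the per-octave cap (it is what any
perturbative attack on the small-slope target needs).  The Albritton–Barker edge is stated
class-independently as `noProfile_of_L3_slices` (Type-I ancient mild + singular origin + slices
bounded in `L³` is impossible), of which `logBlowdownLiouville_of_slope_zero` is the corollary.
P2 (wall width): the first positive-width target inside the open quadrant is TYPED,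
`SmallSlopeLiouville M` (`∃ q₀(M) > 0`, no profile of per-octave cap / slope `≤ q₀`), with its
perturbative plan and the companion weak-`L³` reading in its docstring; STUB 3 implies it
(`smallSlopeLiouville_of_liouville`) and it holds for `M < 1` (`smallSlopeLiouville_of_rate_lt_one`).
P3: this skeleton stays filed-UNREGISTERED (thin_cascade 972f24fcf0c3 keeps the staffing unit).
P4 (numbers in the open quadrant): see STUB 3's docstring.
-/

namespace Summit.NavierStokesRegularity.NavierStokesRegularity.Cruxes.TypeIQuantSubcubicExp.LogBlowdown

open MeasureTheory Filter
open scoped ENNReal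

local notation "E3" => EuclideanSpace ℝ (Fin 3)

/-- The smooth-solution frame of the crux (Tao class on `[0,T]`, `ν = 1`, zero force):
classical solution with every `H^k` seminorm bounded on `[0,T]` (verbatim as in line
`thin-cascade`). -/
def TaoFrame (T : ℝ) (u : ℝ → E3 → E3) (p : ℝ → E3 → ℝ) : Prop :=
  Literature.Analysis.FluidPDE.IsClassicalNSSolutionOn (Set.Icc 0 T) 1 0 u p ∧
    ∀ n : ℕ, ∃ C : NNReal, ∀ t ∈ Set.Icc 0 T,
      eLpNorm (iteratedFDeriv ℝ n (u t)) 2 volume ≤ C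

/-- The `j`-th `e`-adic OCTAVE above the scale `ℓ` around `x₀`: `e^j ℓ ≤ |x − x₀| < e^{j+1} ℓ`. -/
def octave (x₀ : E3) (ℓ : ℝ) (j : ℕ) : Set E3 :=
  {x : E3 | Real.exp (j : ℝ) * ℓ ≤ ‖x - x₀‖ ∧ ‖x - x₀‖ < Real.exp ((j : ℝ) + 1) * ℓ}

/-- A UNIFORMLY CHEAP CASCADE of length `K` with Type-I constant `M`, core allowance `a` and
per-octave cap `q` (centre `x₀`, observation time `T` = the final time of the frame, window base
scale `ρ`): a Tao-frame solution on `[0,T]` with the virtual Type-I bound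
`‖u(t,x)‖ ≤ M (T+τ−t)^{-1/2}`, backward life `T ≥ e^{2K} ρ²`, virtual remaining time
`τ ≤ M² e^{−2K} ρ²`, centre value `ρ ‖u(T,x₀)‖ ≥ e^{K}` (K octaves of concentration below `ρ`),
and — the budget clauses (v2, per-octave form) — at EVERY time `t` of the window
`[T − e^{2K}ρ², T)`: the parabolic CORE `B(x₀, √(T−t))` costs `∫ ‖u(t)‖³ ≤ a`, and EVERY `e`-adic
octave `e^j √(T−t) ≤ |x − x₀| < e^{j+1} √(T−t)` below the window top `e^{K} ρ` costs `≤ q`.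
Consequences (elementary, used by STUB 2): the cumulative budget
`∫_{B(x₀, e^n √(T−t))} ‖u(t)‖³ ≤ a + n q`; by Hölder on each octave
(`∫_oct ‖u‖² ≤ |oct|^{1/3} q^{2/3} ≤ c e^{j} √(T−t) q^{2/3}`) and a geometric sum, the scaled `L²`
mass `r⁻¹ ∫_{B(x,r)} ‖u(t)‖² ≤ c (M² + a^{2/3} + q^{2/3})` for EVERY centre `x` and radius `r` below
the window top (balls with `r ≥ |x−x₀|/2` sit in `B(x₀,3r)`; balls with `r < |x−x₀|/2` meet at
most three octaves and the core; sub-parabolic balls are paid by the rate). -/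
def UniformlyCheapCascade (M a q : ℝ) (K : ℕ) : Prop :=
  ∃ (T τ ρ : ℝ) (x₀ : E3) (u : ℝ → E3 → E3) (p : ℝ → E3 → ℝ),
    TaoFrame T u p ∧ 0 < τ ∧ 0 < ρ ∧
    Real.exp (2 * K) * ρ ^ 2 ≤ T ∧
    τ ≤ M ^ 2 * Real.exp (-2 * (K : ℝ)) * ρ ^ 2 ∧
    (∀ t ∈ Set.Icc 0 T, ∀ x : E3, ‖u t x‖ ≤ M * (T + τ - t) ^ (-(1 / 2 : ℝ))) ∧
    Real.exp K ≤ ρ * ‖u T x₀‖ ∧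
    (∀ t ∈ Set.Ico (T - Real.exp (2 * K) * ρ ^ 2) T,
      ∫⁻ x in Metric.ball x₀ (Real.sqrt (T - t)), ‖u t x‖ₑ ^ (3 : ℝ) ≤ ENNReal.ofReal a) ∧
    ∀ t ∈ Set.Ico (T - Real.exp (2 * K) * ρ ^ 2) T, ∀ j : ℕ,
      Real.exp ((j : ℝ) + 1) * Real.sqrt (T - t) ≤ Real.exp K * ρ →
        ∫⁻ x in octave x₀ (Real.sqrt (T - t)) j, ‖u t x‖ₑ ^ (3 : ℝ) ≤ ENNReal.ofReal q

/-- `v` is SINGULAR at the space–time point `(a, 0)`: unbounded on every backward parabolic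
neighbourhood `B_r(a) × (−r², 0)` (verbatim as in line `thin-cascade`). -/
def SingularAt (v : ℝ → E3 → E3) (a : E3) : Prop :=
  ∀ r : ℝ, 0 < r → ∀ A : ℝ, ∃ t ∈ Set.Ioo (-(r ^ 2)) 0, ∃ y ∈ Metric.ball a r, A < ‖v t y‖

/-- A LOG-BLOWDOWN PROFILE with constants `(M, a, q)`: a Type-I ancient mild field in the tree's
canonical Oseen gauge (`IsTypeIAncientMild M v`: jointly smooth on the open past, divergence free,
Oseen-mild between negative times — no parasitic drifts —, `‖v(s,x)‖ ≤ M/√(−s)`), SINGULAR at the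
space–time origin, with Seregin's scaled local energies `r⁻¹ ∫_{B(x₀,r)} ‖v(s)‖²` bounded over
ALL centres, ALL radii and all `s < 0` (the `A`-part of the Albritton–Barker quantity `𝐈`), and
with the logarithmic BLOW-DOWN SLICE BUDGET: at every time `s < 0` and every radius
`r ≥ √(−s)`, `∫_{B(0,r)} ‖v(s)‖³ ≤ a + q log (r/√(−s))`.  A backward λ-DSS Type-I profile with
envelope constant `C` is such a profile with `q ≤ 4πC³ · max(1, 1/log λ)`-type slope; `q = 0`
means slices bounded in `L³(ℝ³)` at all times (the Albritton–Barker Thm 1.2 hypothesis).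
Version 2 adds the PER-OCTAVE CAP (last clause): every `e`-adic octave
`e^j √(−s) ≤ |y| < e^{j+1} √(−s)`, `j ≥ 0`, costs `≤ q` at every `s < 0` — the datum uniformly
cheap cascades deliver and the one a perturbative (ε-regularity per annulus) attack on
`SmallSlopeLiouville` needs; with the cap the cumulative clause is its sum plus the core, and the
corner `q = 0` of THIS class is degenerate (no mass beyond the parabolic ball) — the honest
Albritton–Barker edge is the class-independent `noProfile_of_L3_slices` below. -/
def LogBlowdownProfile (M a q : ℝ) (v : ℝ → E3 → E3) : Prop :=
  Literature.Analysis.FluidPDE.IsTypeIAncientMild M v ∧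
    SingularAt v 0 ∧
    (∃ I : ℝ, ∀ (x₀ : E3) (r : ℝ), 0 < r → ∀ s : ℝ, s < 0 →
      ∫⁻ y in Metric.ball x₀ r, ‖v s y‖ₑ ^ (2 : ℝ) ≤ ENNReal.ofReal (I * r)) ∧
    (∀ s : ℝ, s < 0 → ∀ r : ℝ, Real.sqrt (-s) ≤ r →
      ∫⁻ x in Metric.ball (0 : E3) r, ‖v s x‖ₑ ^ (3 : ℝ)
        ≤ ENNReal.ofReal (a + q * Real.log (r / Real.sqrt (-s)))) ∧
    ∀ s : ℝ, s < 0 → ∀ j : ℕ,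
      ∫⁻ x in octave 0 (Real.sqrt (-s)) j, ‖v s x‖ₑ ^ (3 : ℝ) ≤ ENNReal.ofReal q

/-- STUB 1 (size L/XL; the dynamical content of the line).  If the subcubic-exponential rate fails
then, for the offending Type-I constant `M` and some `(a, q)`, uniformly cheap cascades of every
length exist.  Proof plan.  (a) As in `thin-cascade` STUB 1: a violator `‖u(t₁,x₀)‖ √t₁ = F`,
`K₀ := ⌊log F⌋ ≥ εA³`, restricted in time to `[0,t₁]`, gives `K₀` octaves `e^k r₀ < |x−x₀| <
e^{k+1} r₀` above `r₀ := √t₁/F`, of total cost `≤ ‖u(t)‖₃³ ≤ A³` AT EVERY TIME.  (b) CORE AND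
LOW OCTAVES ARE FREE: at time `t` the ball `B(x₀, R√(t₁−t))` costs `≤ (4π/3) R³ M³` by the virtual
Type-I bound alone, so the core clause holds with `a := (4π/3) M³` and the per-octave cap `q`
holds for the octaves `j < n₀ := ⌊(1/3) log (q / ((4π/3)(e³−1) M³))⌋` at every time, uniformly in
`A`; only the octaves `j ≥ n₀` are dynamical (v2 typing: the object records the PER-OCTAVE cap, which
is what (c)–(d) produce, not merely the cumulative budget).  (c) TWO-PARAMETER RISING SUN: index cells by (octave `j`, parabolic
time-band `I_l := [t₁ − e^{2(l+1)} r₀², t₁ − e^{2l} r₀²]`), cost `c_{j,l} := sup_{t ∈ I_l}` (cost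
of octave `j` at time `t`), `j ≥ l + n₀`; every band has `Σ_j c_{j,l} ≤ A³`, so the triangular
array over a window of `K'` octaves has average cell cost `≤ 2A³/K' = O(1/ε)`; the discrete
rising-sun lemma in `j` at fixed `l` bounds the bad START octaves of band `l` by `A³/q`.  (d) THE
HARD CORE (why L/XL and why it might fail): the start octave of band `l` is PINNED to `l + n₀` (the
budget is measured from the parabolic scale of the time itself), so (c) does not by counting alone
exclude an INWARD-TRACKING FAT SHELL — cost `> q` sitting at `≈ e^{n₀}` parabolic radii at every
time, created at the shrinking shell and destroyed behind it at rate `≍ q` per band (forced by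
`Σ_j c_j(t) ≤ A³`).  Excluding it needs a parabolic quasi-stationarity lemma for octaves at
`≥ e^{n₀}` parabolic radii under the Type-I rate (displacement `≤ 2M√(t₁−t) ≪` octave width and
diffusion length `√(t₁−t) ≪` octave width are free; the `L³`-creation rate at the shell is the
issue) — the same input Albritton–Barker 2019 Remark 3.2 name as missing between the time-Type-I
rate and local energy bounds up to the blow-up time.  Cheapest falsifier: a smooth Type-I-rate flow
(numerical or exact, e.g. a truncated backward-DSS candidate of pub-ns-dss) whose `L³` octave costs
measured from the running parabolic scale are NOT eventually `O(1)` per octave while the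
final-time costs are. -/
theorem stub_uniformlyCheapCascades :
    ¬ Summit.NavierStokesRegularity.NavierStokesRegularity.Theses.QuarterLogPincer.TypeIQuantSubcubicExp →
      ∃ M a q : ℝ, ∀ K : ℕ, UniformlyCheapCascade M a q K := by
  sorry

/-- STUB 2 (size L in Lean, compactness infrastructure; every analytic input is a tree theorem).
Uniformly cheap cascades of every length produce a log-blowdown profile.  Proof plan: recentre
and rescale at the window base, `v_K(y,s) := ρ_K u_K(x₀^K + ρ_K y, T_K + ρ_K² s)` on
`s ∈ [−e^{2K}, 0]`; the virtual Type-I clause gives `‖v_K(y,s)‖ ≤ M/√(−s − τ_K/ρ_K²)` with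
`τ_K/ρ_K² ≤ M² e^{−2K} → 0`; the core clause and the per-octave cap are scale invariant and
become `∫_{B(0,√(−s))} ‖v_K(s)‖³ ≤ a`, `∫_{octave_j(0,√(−s))} ‖v_K(s)‖³ ≤ q` for the octaves below
`e^{K}`, all `s ∈ [−e^{2K}, 0)`; summed, `∫_{B(0,r)} ‖v_K(s)‖³ ≤ a + q log (r/√(−s)) + q`.
SCALED ENERGIES FOR FREE (this is where uniform cheapness is consumed, and why v2 records the
PER-OCTAVE cap — cumulative bounds do not subtract): Hölder on each octave gives the octave `L²`
mass `≤ c e^{j} √(−s) q^{2/3}`, a geometric sum gives `r⁻¹ ∫_{B(x,r)} ‖v_K(s)‖² ≤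
c (M² + a^{2/3} + q^{2/3})` for EVERY centre `x` and radius `r` (the all-centres clause of the
profile: balls with `r ≥ |x|/2` sit in `B(0,3r)`, balls with `r < |x|/2` meet at most three
octaves and the core, sub-parabolic balls are paid by the rate); integrating the caps over the
parabolic time of a ball gives Seregin's `C(r; (0,x)) = r⁻² ∫_{−r²}^{0}∫_{B(x,r)} |v_K|³ ≤
a + q/2 + 4q` uniformly in `K` and in the centre (a ball meets, at time `s`, the core or at most
`log (3r/√(−s)) + 1` octaves when `|x| ≤ 2r`, and at most three octaves otherwise), and the local
pressure split (near part from the `L³` budget on `B(x,2r)`, harmonic part from the octave `L²`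
masses `≤ c q^{2/3} e^{j}√(−s)` summed against `|y|⁻³`, far part beyond the window top
`≤ c A_K² e^{−K} → 0` BECAUSE the cascade length `K ≥ εA_K³` beats `2 log A_K`) bounds `D(r)`;
then the tree's Seregin–Šverák Lemma 3.5 form
`Literature.Analysis.FluidPDE.scaledEnergies_bounded_of_typeIRate` (Type-I rate + `C, D < ∞` ⇒
`A + E + C + D` bounded) puts the `v_K` in the Albritton–Barker local-energy Type-I frame with
`𝐈 ≤ I(M,a,q)` uniformly (Albritton–Barker 2019 Remark 3.2: the time rate ALONE does not give this —
the budget does).  COMPACTNESS + PERSISTENCE by name: the windowed form of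
`Literature.Analysis.FluidPDE.slab_typeI_compactness` (A–B §3 engine: `L³_loc` subsequence limit,
suitable on the slab, `𝐈 ≤ 4I`, and a backward-singular origin because
`‖v_K‖_{L^∞(Q(0,R))} ≥ ρ_K ‖u_K(T_K, x₀^K)‖ ≥ e^{K} → ∞`; ingredients `SuitableCompactness_holds`,
`PersistenceOfSingularities_holds`), then the Oseen-gauge smooth representative
`exists_oseenMild_repr_of_typeIBound_lt_top` / `exists_classical_repr_of_typeIBound_lt_top`
(slab suitable + rate + `𝐈 < ∞` ⇒ a continuous, smooth, Oseen-mild field with the rate everywhere,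
i.e. `IsTypeIAncientMild M v` after a.e. modification); the budgets and the scaled `L²` bound pass
to the limit by Fatou / lower semicontinuity at each fixed `s < 0`; `SingularAt v 0` from the
backward-singular origin and continuity.  Why it might fail: only through a Lean-side mismatch of
frames (window vs slab, virtual time shift `τ_K/ρ_K²`), not mathematically. -/
theorem stub_logBlowdownExtraction :
    ∀ M a q : ℝ, (∀ K : ℕ, UniformlyCheapCascade M a q K) →
      ∃ (M' a' q' : ℝ) (v : ℝ → E3 → E3), LogBlowdownProfile M' a' q' v := by
  sorry

/-- STUB 3 (DECIDING; size XL; ON THE DSS WALL).  LOG-BLOWDOWN LIOUVILLE: there is no log-blowdown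
profile.  Edges PROVED below: `q = 0` for every `M` (Albritton–Barker 2019 Thm 1.2 via the tree's
`albrittonBarker_liouville_L3_core`: bounded-`L³` blow-down slices ⇒ `v ≡ 0` on the past ⇒ not
singular) and `M < 1` for every `q` (T31⁗ `typeI_ancient_eq_zero_of_rate_lt_one`).  Open content:
the quadrant `M ≥ 1, q > 0`.  Road and its exact failure point: zoom out along `√(−s_k)`; the
blow-down limit is again a log-blowdown profile (the class is blow-down invariant), singular at the
origin by persistence; the ESS/A–B contradiction needs the blow-down of the final datum to VANISH
(trace in the class `𝔹` of A–B Thm 4.1, tree fact `AlbrittonBarker2019_liouville_weakL3_backward`),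
which a budget of positive log-slope does not give — a λ-DSS profile is a fixed point of the
blow-down.  Why it might fail: a backward-DSS Type-I profile of some ratio `λ ≥ λ_*(C)`
(Chae–Wolf 2017 exclude only `λ` near one; Bradshaw–Tsai 2017 §5: none known, none excluded)
refutes it, 24077 and SuperlogCubeRate at once.  Instrument: pub-ns-dss backward-DSS profile
searches, reading off the per-octave cap / log-slope `q(λ, M) = sup_j ∫_{octave_j} |U|³` of a
converged profile.  NUMBERS IN THE OPEN QUADRANT (price P4; scale for «small slope»): an enveloped
profile `|U(y,s)| ≤ C/(|y| + √(−s))` has rate constant `M ≤ C` and per-octave cap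
`q ≤ ∫_{e^j ≤ |y| < e^{j+1}} C³ |y|⁻³ dy = 4π C³` for every ratio `λ` (the cumulative slope obeys
the same bound up to the factor `max(1, 1/log λ)` when a period is shorter than an octave); the
pub-ns-dss census (SEARCH-LEDGER §A–§B: ratio boxes `L = 2 log λ ∈ {1, 2, 4}`, i.e.
`λ ∈ {1.65, 2.72, 7.39}`, amplitude levels `C = sup (1+|y|)|U| ∈ {1, 3, 10, 30, 100}`, classes
K0a–K0g controls and K1-C2h/C3h/…, result «0 nontrivial» at resolution R1 with R2 control — a
labelled numerical statement, NOT an exclusion) therefore sits at `(M, q) ≤ (3, 3.4·10²)`,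
`(10, 1.3·10⁴)`, `(30, 3.4·10⁵)`, `(100, 1.3·10⁷)` against the proved edges `q = 0` (every `M`)
and `M < 1` (every `q`); Chae–Wolf's `λ < λ_*(C)` exclusion and the GKT small-`C` end
(`C < ε` ⇒ `M < 1`, inside RUNG 2) are the only theorems in the quadrant.  FIRST POSITIVE-WIDTH
TARGET (price P2): `SmallSlopeLiouville M` below (`∃ q₀(M) > 0`); until a prover stands there,
this stub carries no prover (instrument-only, like thin_cascade S3). -/
theorem stub_logBlowdownLiouville :
    ∀ (M a q : ℝ) (v : ℝ → E3 → E3), ¬ LogBlowdownProfile M a q v := by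
  sorry

/-- Exhaustion of `ℝ³` by balls: if `∫_{B(0,r)} f ≤ C` for all `r ≥ r₀` then `∫ f ≤ C`
(monotone union of the balls `B(0,n+1)`). -/
theorem lintegral_le_of_forall_ball {f : E3 → ℝ≥0∞} {C : ℝ≥0∞} {r₀ : ℝ}
    (h : ∀ r : ℝ, r₀ ≤ r → ∫⁻ x in Metric.ball (0 : E3) r, f x ≤ C) :
    ∫⁻ x, f x ≤ C := by
  have hU : (⋃ n : ℕ, Metric.ball (0 : E3) ((n : ℝ) + 1)) = Set.univ :=
    Metric.iUnion_ball_nat_succ 0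
  have hdir : Directed (· ⊆ ·) (fun n : ℕ => Metric.ball (0 : E3) ((n : ℝ) + 1)) := by
    refine directed_of_isDirected_le fun m n hmn => Metric.ball_subset_ball ?_
    have : (m : ℝ) ≤ n := by exact_mod_cast hmn
    linarith
  have hball : ∀ n : ℕ, ∫⁻ x in Metric.ball (0 : E3) ((n : ℝ) + 1), f x ≤ C := by
    intro n
    by_cases hn : r₀ ≤ (n : ℝ) + 1
    · exact h _ hn
    · push_neg at hn
      exact (lintegral_mono_set (Metric.ball_subset_ball hn.le)).trans (h r₀ le_rfl)
  calc ∫⁻ x, f x = ∫⁻ x in Set.univ, f x := by rw [Measure.restrict_univ]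
    _ = ∫⁻ x in ⋃ n : ℕ, Metric.ball (0 : E3) ((n : ℝ) + 1), f x := by rw [hU]
    _ = ⨆ n : ℕ, ∫⁻ x in Metric.ball (0 : E3) ((n : ℝ) + 1), f x :=
        setLIntegral_iUnion_of_directed f hdir
    _ ≤ C := iSup_le hball

/-- THE ALBRITTON–BARKER EDGE (proved, class-independent; every `M`): a Type-I ancient mild field
singular at the space–time origin cannot have slices bounded in `L³(ℝ³)` at every negative time —
after a time shift it is a bounded Oseen-mild ancient field bounded in `L³` along
`s_k = −k−1 → −∞`, hence vanishes on the past by Albritton–Barker 2019 Thm 1.2 (tree theorem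
`albrittonBarker_liouville_L3_core`), contradicting the singularity.  This is the near-miss of
record made kernel-checked: the deciding stub minus exactly the logarithm (uniformly `ℓ¹` octave
costs instead of uniformly capped ones). -/
theorem noProfile_of_L3_slices (M a : ℝ) (v : ℝ → E3 → E3)
    (hv : Literature.Analysis.FluidPDE.IsTypeIAncientMild M v) (hsing : SingularAt v 0)
    (hslice : ∀ s : ℝ, s < 0 → ∫⁻ x, ‖v s x‖ₑ ^ (3 : ℝ) ≤ ENNReal.ofReal a) : False := by
  -- (1) slices bounded in L³ at every negative time
  have hfin : ENNReal.ofReal a ^ (1 / 3 : ℝ) ≠ ⊤ :=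
    ENNReal.rpow_ne_top_of_nonneg (by norm_num) ENNReal.ofReal_ne_top
  have hL3 : ∀ s : ℝ, s < 0 → eLpNorm (v s) 3 volume ≤ ENNReal.ofReal a ^ (1 / 3 : ℝ) := by
    intro s hs
    have hint : ∫⁻ x, ‖v s x‖ₑ ^ (3 : ℝ) ≤ ENNReal.ofReal a := hslice s hs
    rw [eLpNorm_eq_lintegral_rpow_enorm (by norm_num) (by norm_num)]
    have h3 : (3 : ℝ≥0∞).toReal = 3 := by norm_num
    rw [h3]
    exact ENNReal.rpow_le_rpow hint (by norm_num)
  -- (2) vanishing on the past, via a time shift and Albritton–Barker Thm 1.2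
  have hzero : ∀ t : ℝ, t < 0 → ∀ x : E3, v t x = 0 := by
    intro t ht x
    obtain ⟨δ, hδ, hδt⟩ : ∃ δ : ℝ, 0 < δ ∧ t / 2 - δ = t := ⟨-t / 2, by linarith, by ring⟩
    have hw := hv.comp_sub_right hδ.le
    have hK : ∀ τ : ℝ, τ < 0 → ∀ y : E3, ‖(fun τ' => v (τ' - δ)) τ y‖ ≤ M / Real.sqrt δ := by
      intro τ hτ y
      show ‖v (τ - δ) y‖ ≤ M / Real.sqrt δ
      refine (hv.norm_le (t := τ - δ) (by linarith) y).trans ?_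
      exact div_le_div_of_nonneg_left hv.nonneg (Real.sqrt_pos.2 hδ)
        (Real.sqrt_le_sqrt (by linarith))
    have hτlt : ∀ k : ℕ, -((k : ℝ) + 1) < 0 := fun k => by
      have : (0 : ℝ) ≤ k := k.cast_nonneg
      linarith
    have hτ : Tendsto (fun k : ℕ => -((k : ℝ) + 1)) atTop atBot :=
      tendsto_neg_atTop_atBot.comp (tendsto_natCast_atTop_atTop.atTop_add tendsto_const_nhds)
    have hτM : ∀ k : ℕ, eLpNorm ((fun τ' => v (τ' - δ)) (-((k : ℝ) + 1))) 3 volume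
        ≤ ((ENNReal.ofReal a ^ (1 / 3 : ℝ)).toNNReal : ℝ≥0∞) := by
      intro k
      rw [ENNReal.coe_toNNReal hfin]
      exact hL3 _ (by linarith [hτlt k])
    have hcore := Literature.Analysis.FluidPDE.albrittonBarker_liouville_L3_core
      (v := fun τ' => v (τ' - δ)) hw.continuousOn_uncurry hK
      (fun τ hτ => hw.isWeaklyDivFree hτ)
      (fun s' t' hst ht' y => hw.mild_eq_heatExtension hst ht' y)
      hτlt hτ hτM (t₀ := t / 4) (by linarith)
    have h := hcore (t / 2) (by linarith) x
    simpa only [hδt] using h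
  -- (3) contradiction with the singularity at the origin
  obtain ⟨t, ht, y, -, hy⟩ := hsing 1 one_pos 0
  have := hzero t ht.2 y
  simp [this] at hy

/-- RUNG 1 (proved; the `q = 0` corner of the class, every `M`): a log-blowdown profile with
log-slope `0` has slices bounded in `L³(ℝ³)` (cumulative clause + exhaustion by balls), so
`noProfile_of_L3_slices` applies.  (In v2 the class also caps every octave by the same `q`, so this
corner is degenerate; the Albritton–Barker content is `noProfile_of_L3_slices` itself.) -/
theorem logBlowdownLiouville_of_slope_zero (M a : ℝ) (v : ℝ → E3 → E3) :
    ¬ LogBlowdownProfile M a 0 v := by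
  rintro ⟨hv, hsing, -, hbud, -⟩
  refine noProfile_of_L3_slices M a v hv hsing fun s hs => ?_
  refine lintegral_le_of_forall_ball (r₀ := Real.sqrt (-s)) fun r hr => ?_
  simpa using hbud s hs r hr

/-- RUNG 2 (proved; the `M < 1` edge, every `q`): by the tree's time-only small-constant Liouville
theorem `SimilarityEnstrophy.typeI_ancient_eq_zero_of_rate_lt_one` (T31⁗) a Type-I ancient mild
field with `M < 1` vanishes on the past, so it is not singular at the origin. -/
theorem logBlowdownLiouville_of_rate_lt_one (M a q : ℝ) (v : ℝ → E3 → E3) (hM : M < 1) :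
    ¬ LogBlowdownProfile M a q v := by
  rintro ⟨hv, hsing, -⟩
  have h0 := Summit.NavierStokesRegularity.NavierStokesRegularity.Theorems.SimilarityEnstrophy.typeI_ancient_eq_zero_of_rate_lt_one hv hM
  obtain ⟨t, ht, y, -, hy⟩ := hsing 1 one_pos 0
  have hz : v t y = 0 := h0 t ht.2 y
  simp [hz] at hy

/-- FIRST POSITIVE-WIDTH TARGET inside the open quadrant (price P2; a TARGET, not a stub — it is
implied by STUB 3 and is the only place a prover could stand on it): for the Type-I constant `M`
there is a threshold `q₀(M) > 0` below which no log-blowdown profile exists (per-octave cap and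
log-slope `≤ q₀`).  Why positive width: an enveloped backward λ-DSS profile has cap `q = 4πC³`-size
with `C ≥ M ≥ 1` (RUNG 2), far from small `q`; so the target excludes only profiles that are Type-I
of size `M` in time yet deposit almost no cube in ANY octave beyond the parabolic ball — including
the first one, where the rate alone would allow `(4π/3)(e³−1)M³`.  Perturbative plan: per-octave
smallness + the rate give, by ε-regularity on each annulus × its parabolic time band (CKN / the
tree's GKT-type criteria), `|v(y,s)| ≤ c q₀^{1/3}/|y|` for `|y| ≥ C√(−s)`, i.e. a SMALL envelope
off the parabolic core; then the blow-down along `√(−s_k) → ∞` is small in weak-`L³` away from the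
origin ray and the Albritton–Barker local-energy frame (all-centres clause) makes it converge; the
companion reading «small `(a, q)` jointly = the small weak-`L³` regime» of the tree fact
`Literature.Analysis.FluidPDE.AlbrittonBarker2019_liouville_weakL3_backward` (A–B Thm 4.1:
weak-`L³` ancient mild + vanishing blow-down of a slice ⇒ zero) is the intended closing tool.
CAVEAT recorded for the prover: a per-octave cap does NOT by itself give a global weak-`L³` bound
(a blob of fixed height in every octave has capped octaves and infinite weak-`L³` norm) — the
in-annulus concentration must first be excluded by the ε-regularity step; this is the same
condensing-blob enemy as STUB 1's fat shell and as line `slice-budget`'s deciding stub on 23843. -/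
def SmallSlopeLiouville (M : ℝ) : Prop :=
  ∃ q₀ : ℝ, 0 < q₀ ∧ ∀ (a q : ℝ) (v : ℝ → E3 → E3), q ≤ q₀ → ¬ LogBlowdownProfile M a q v

/-- STUB 3 implies the small-slope target for every `M` (bookkeeping, proved). -/
theorem smallSlopeLiouville_of_liouville
    (h : ∀ (M a q : ℝ) (v : ℝ → E3 → E3), ¬ LogBlowdownProfile M a q v) (M : ℝ) :
    SmallSlopeLiouville M :=
  ⟨1, one_pos, fun a q v _ => h M a q v⟩

/-- The small-slope target holds on the `M < 1` edge (RUNG 2), with any threshold. -/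
theorem smallSlopeLiouville_of_rate_lt_one (M : ℝ) (hM : M < 1) : SmallSlopeLiouville M :=
  ⟨1, one_pos, fun a q v _ => logBlowdownLiouville_of_rate_lt_one M a q v hM⟩

/-- COMPOSITION (kernel-checked, no `sorry`): the three stubs prove the crux BY NAME. -/
theorem TypeIQuantSubcubicExp_of :
    (¬ Summit.NavierStokesRegularity.NavierStokesRegularity.Theses.QuarterLogPincer.TypeIQuantSubcubicExp →
        ∃ M a q : ℝ, ∀ K : ℕ, UniformlyCheapCascade M a q K) →
    (∀ M a q : ℝ, (∀ K : ℕ, UniformlyCheapCascade M a q K) →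
        ∃ (M' a' q' : ℝ) (v : ℝ → E3 → E3), LogBlowdownProfile M' a' q' v) →
    (∀ (M a q : ℝ) (v : ℝ → E3 → E3), ¬ LogBlowdownProfile M a q v) →
      Summit.NavierStokesRegularity.NavierStokesRegularity.Theses.QuarterLogPincer.TypeIQuantSubcubicExp := by
  intro h₁ h₂ h₃
  by_contra h
  obtain ⟨M, a, q, hK⟩ := h₁ h
  obtain ⟨M', a', q', v, hv⟩ := h₂ M a q hK
  exact h₃ M' a' q' v hv

/-- The composition instantiated with the registered stubs. -/
theorem TypeIQuantSubcubicExp_of_stubs :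
    Summit.NavierStokesRegularity.NavierStokesRegularity.Theses.QuarterLogPincer.TypeIQuantSubcubicExp :=
  TypeIQuantSubcubicExp_of stub_uniformlyCheapCascades stub_logBlowdownExtraction
    stub_logBlowdownLiouville

end Summit.NavierStokesRegularity.NavierStokesRegularity.Cruxes.TypeIQuantSubcubicExp.LogBlowdown
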